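import Mathlib.GroupTheory.SpecificGroups.Cyclic
import Literature.IUT.HodgeTheaters.PuncturedEllipticCoveringsCharacteristic
import Literature.IUT.HodgeTheaters.PuncturedEllipticCoveringsCusps
import Literature.IUT.HodgeTheaters.PuncturedEllipticCoveringsCuspRecovery
import HarnessLib

/-!
# [IUTchI] Corollary 1.2, proof p. 39: the splitting step and the last sentence, at the level of
# `Π_C` and the Galois action on the cusps — proof-only kernels

Mochizuki, *Inter-universal Teichmüller theory I*, kurims manuscript (May 2020), §1, Corollary 1.2,
PROOF, p. 39 ([IUTchI] Cor 1.2 p.39) [claim: Mochizuki2012, status: disputed].  Proof-only companion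
(no definitions, nothing restated) over abc-iut-L5-t1's FROZEN `PuncturedEllipticCoverings.lean` and
its additive interface companion `PuncturedEllipticCoveringsCusps.lean` (`CuspGalois`: the action of
`Gal(X̲/C) = Π_C/Π_X̲` on the cusps of `X̲`, consumed BY NAME), continuing
`PuncturedEllipticCoveringsCuspRecovery.lean` (abc-iut-L5-d4: the inertia-level criterion and the
`ZMod`-level heart of the splitting step).  The anabelian inputs of the printed proof are NOT touched;
no side is taken on [IUTchIII] Cor. 3.12.

* THE SPLITTING STEP (p. 39): "to reconstruct `Π_C̲ ⊆ Π_C`, it suffices to reconstruct the splitting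
  of the surjection `Gal(X̲/C) = Π_C/Π_X̲ ↠ Π_C/Π_X = Gal(X/C)` determined by `Gal(X̲/C̲) = Π_C̲/Π_X̲`;
  but [since `l` is prime to `3`!] this splitting may be characterized [group-theoretically!] as the
  unique splitting that stabilizes the collection of conjugacy classes of subgroups of `Π_X̲` determined
  by the decomposition groups of `ε⁰, ε′, ε″`."  KERNEL FORM (`ArrowCoveringClaims.mem_piCbar_iff_act_stabilizes`,
  `ArrowCoveringClaims.mem_piCbar_iff`): under the printed claims of p. 38 and with `#Cusp(X̲) = l`
  [[IUTchI] Def. 3.1 (d); the frozen record does not carry this equality, so it is an explicit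
  hypothesis `hcard`], an element `s ∈ Π_C ∖ Π_X` lies in `Π_C̲` IF AND ONLY IF its action on the cusps
  of `X̲` stabilises the three-element set `{ε⁰, ε′, ε″}` — so `Π_C̲ = Π_X̲ ∪ {s ∉ Π_X stabilising it}` is
  recovered from `Π_X ⊇ Π_X̲`, the cusp action and the three labels.  [The cusps form a torsor under the
  cyclic group `Gal(X̲/X) = Π_X/Π_X̲` of order `l`; an element of the non-trivial coset acts by
  `n ↦ -n - b`, and `{0, k, -k}` (`ε′ = k ≠ 0`) is stabilised iff `b = 0` because `2, 3 ∈ (ℤ/l)^×` —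
  `Cor12Splitting.eq_zero_of_reflection_stabilizes`.]
* THE LAST SENTENCE (p. 39–40): "the decomposition groups of `ε′, ε″` in `Π_X̲` may be recovered as the
  decomposition groups of cusps … whose image in `Gal(X̲→/X̲) = Π_X̲/Π_{X̲→}` is nontrivial, but which
  are not fixed [up to conjugacy] by the outer action of `Gal(X̲/C̲) = Π_C̲/Π_X̲` on `Π_X̲`."  KERNEL FORM
  at the inertia/cusp-label level (`ArrowCoveringClaims.setOf_not_inertia_le_and_moved_eq`): for any
  `ι̲ ∈ Π_C̲ ∖ Π_X`, `{x | I_x ⊄ Π_{X→} and ι̲·x ≠ x} = {ε′, ε″}` [`ε⁰` is `ι̲`-fixed, the other nonzero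
  cusps are unramified; `ε⁰`'s own ramification is not among the typed claims and is not needed].

Small interface consequences proved on the way (the public forms of the first two are in abc-iut-L5-t1's
proof companion `PuncturedEllipticCoveringsCuspsProofs`; kept `private` here to avoid twins):
`Π_X̲` acts trivially; `ι̲ ∘ g = g⁻¹ ∘ ι̲`; `ArrowCoveringClaims.exists_mem_piCbar_not_mem_piX`
(`Π_C̲ ⊄ Π_X`, from `[Π_C̲ : Π_X̲] = 2`); `CuspGalois.act_ε2` (`ι̲ ε″ = ε′`); `CuspGalois.card_cusp_eq_orderOf`
(`#Cusp(X̲) =` the order of a generator of `Gal(X̲/X)` acting).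
-/

namespace Literature.IUT.HodgeTheaters

namespace PuncturedEllipticData

open scoped Pointwise
open Literature.AnabelianGeometry.AbsoluteAnabelian

universe u

variable {D : PuncturedEllipticData.{u}}

/-! ### Helpers over the cusp action -/

namespace CuspGalois

variable (C : D.CuspGalois)

/-- `Π_X̲` acts trivially on the cusps of `X̲` (public form: abc-iut-L5-t1's `act_eq_one_of_mem_PiXbar`
in its proof companion). ([IUTchI] §1 p.37) [claim: Mochizuki2012, status: disputed] -/
private theorem act_eq_one_of_mem_PiXbar₀ {g : D.PiC} (hg : g ∈ D.PiXbar) : C.act g = 1 := by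
  ext x
  obtain ⟨t, ht, h⟩ := C.act_decomp g x
  have := C.eq_of_conj x (C.act g x) (t * g) (D.PiXbar.mul_mem ht hg) h
  simp [← this]

/-- `ι̲ (g·x) = g⁻¹·(ι̲ x)` for `g ∈ Π_X`, `ι̲ ∈ Π_C̲ ∖ Π_X` ([EtTh] Rmk. 2.1.1: "`ι̲` acts on `Q` by `−1`";
public form: abc-iut-L5-t1's `act_act_of_mem_PiCbar`). ([IUTchI] §1 p.37) [claim: Mochizuki2012, status: disputed] -/
private theorem act_act_of_mem_PiCbar₀ {c g : D.PiC} (hc : c ∈ D.PiCbar) (hcX : c ∉ D.PiX)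
    (hg : g ∈ D.PiX) (x : D.Cusp) : C.act c (C.act g x) = C.act g⁻¹ (C.act c x) := by
  have h := C.act_eq_one_of_mem_PiXbar₀ (C.conj_mul_mem_PiXbar c hc hcX g hg)
  rw [map_mul, map_mul, map_mul, map_inv] at h
  -- `act c * act g * (act c)⁻¹ * act g = 1`
  have h' : C.act c * C.act g = (C.act g)⁻¹ * C.act c := by
    calc C.act c * C.act g = C.act c * C.act g * (C.act c)⁻¹ * C.act g * ((C.act g)⁻¹ * C.act c) := by
            group
      _ = (C.act g)⁻¹ * C.act c := by rw [h, one_mul]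
  have := congrArg (fun σ : Equiv.Perm D.Cusp => σ x) h'
  simpa only [Equiv.Perm.mul_apply, map_inv] using this

/-- **`ι̲ ε″ = ε′`**: an element of `Π_C̲ ∖ Π_X` switches the two cusps over `ε̲` both ways (its square
lies in `Π_X ∩ Π_C̲ = Π_X̲`, which acts trivially). ([IUTchI] §1 p.37) [claim: Mochizuki2012, status: disputed] -/
theorem act_ε2 {c : D.PiC} (hc : c ∈ D.PiCbar) (hcX : c ∉ D.PiX) : C.act c D.ε2 = D.ε1 := by
  have hcc : c * c ∈ D.PiXbar :=
    ⟨Subgroup.mul_self_mem_of_index_two D.index_piX c, D.PiCbar.mul_mem hc hc⟩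
  have h1 : C.act c D.ε1 = D.ε2 := C.act_ε1 c hc hcX
  have h2 : C.act (c * c) D.ε1 = D.ε1 := by rw [C.act_eq_one_of_mem_PiXbar₀ hcc]; rfl
  rw [map_mul, Equiv.Perm.mul_apply, h1] at h2
  exact h2

/-- An element of `Π_C̲` permutes the three cusps `{ε⁰, ε′, ε″}` (trivially if it lies in `Π_X̲`, as
`ι̲` otherwise). ([IUTchI] Cor 1.2 p.39) [claim: Mochizuki2012, status: disputed] -/
theorem act_mem_triple_of_mem_piCbar {c : D.PiC} (hc : c ∈ D.PiCbar) {x : D.Cusp}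
    (hx : x ∈ ({D.ε0, D.ε1, D.ε2} : Set D.Cusp)) :
    C.act c x ∈ ({D.ε0, D.ε1, D.ε2} : Set D.Cusp) := by
  by_cases hcX : c ∈ D.PiX
  · have : C.act c = 1 := C.act_eq_one_of_mem_PiXbar₀ ⟨hcX, hc⟩
    rw [this]; exact hx
  · simp only [Set.mem_insert_iff, Set.mem_singleton_iff] at hx ⊢
    rcases hx with rfl | rfl | rfl
    · exact Or.inl (C.act_ε0 c hc)
    · exact Or.inr (Or.inr (C.act_ε1 c hc hcX))
    · exact Or.inr (Or.inl (C.act_ε2 hc hcX))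

/-- **`#Cusp(X̲)` is the order of (the action of) a generator of `Gal(X̲/X)`**: for `γ ∈ Π_X` whose
action generates that of `Π_X`, the orbit map `⟨act γ⟩ → Cusp(X̲)`, `σ ↦ σ ε⁰`, is a bijection (free
and transitive action). ([IUTchI] §1 p.37) [claim: Mochizuki2012, status: disputed] -/
theorem card_cusp_eq_orderOf {γ : D.PiC} (hγ : γ ∈ D.PiX)
    (hgen : ∀ h ∈ D.PiX, ∃ n : ℤ, C.act h = C.act γ ^ n) :
    Nat.card D.Cusp = orderOf (C.act γ) := by
  classical
  -- powers of `act γ` fixing `ε⁰` are trivial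
  have hfix : ∀ n : ℤ, (C.act γ ^ n) D.ε0 = D.ε0 → C.act γ ^ n = 1 := by
    intro n hn
    rw [← map_zpow] at hn ⊢
    exact C.act_eq_one_of_mem_PiXbar₀ (C.free _ (D.PiX.zpow_mem hγ n) D.ε0 hn)
  rw [← Nat.card_zpowers]
  refine (Nat.card_congr (Equiv.ofBijective (fun σ : Subgroup.zpowers (C.act γ) => (σ : Equiv.Perm D.Cusp) D.ε0) ⟨?_, ?_⟩)).symm
  · rintro ⟨σ, hσ⟩ ⟨σ', hσ'⟩ hστ
    obtain ⟨n, rfl⟩ := Subgroup.mem_zpowers_iff.mp hσ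
    obtain ⟨m, rfl⟩ := Subgroup.mem_zpowers_iff.mp hσ'
    simp only at hστ
    apply Subtype.ext
    show C.act γ ^ n = C.act γ ^ m
    have h1 : (C.act γ ^ (n - m)) D.ε0 = D.ε0 := by
      rw [show n - m = -m + n by ring, zpow_add, zpow_neg, Equiv.Perm.mul_apply, hστ]
      simp
    have h2 := hfix (n - m) h1
    rwa [zpow_sub, mul_inv_eq_one] at h2
  · intro x
    obtain ⟨g, hg, hgx⟩ := C.transitive D.ε0 x
    obtain ⟨n, hn⟩ := hgen g hg
    exact ⟨⟨C.act γ ^ n, Subgroup.mem_zpowers_iff.mpr ⟨n, rfl⟩⟩, by simpa [← hn] using hgx⟩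

end CuspGalois

/-! ### `Π_C̲ ⊄ Π_X` and the last sentence of the proof -/

/-- Under the printed claims of p. 38, `Π_C̲ ⊄ Π_X` (`[Π_C̲ : Π_X̲] = 2`), i.e. an element
`ι̲ ∈ Π_C̲ ∖ Π_X` exists. ([IUTchI] §1 p.38) [claim: Mochizuki2012, status: disputed] -/
theorem ArrowCoveringClaims.exists_mem_piCbar_not_mem_piX (h : D.ArrowCoveringClaims) :
    ∃ c ∈ D.PiCbar, c ∉ D.PiX := by
  by_contra hne
  push Not at hne
  have hle : D.PiCbar ≤ D.PiXbar := fun c hc => ⟨hne c hc, hc⟩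
  have h1 : D.PiXbar.relIndex D.PiCbar = 1 := Subgroup.relIndex_eq_one.mpr hle
  rw [h.relIndex_piXbar] at h1
  exact absurd h1 (by decide)

/-- **Cor. 1.2, proof, last sentence (pp. 39–40), at the inertia / cusp-label level.**  Under the
printed claims of p. 38 and the cusp action, for any `ι̲ ∈ Π_C̲ ∖ Π_X` the cusps `x` of `X̲` whose
inertia group is NOT contained in `Π_{X→}` ["image in `Gal(X̲→/X̲)` nontrivial"] and which are MOVED by
`ι̲` ["not fixed by the outer action of `Gal(X̲/C̲)`"] are exactly `ε′, ε″`.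
([IUTchI] Cor 1.2 p.39) [claim: Mochizuki2012, status: disputed] -/
theorem ArrowCoveringClaims.setOf_not_inertia_le_and_moved_eq (h : D.ArrowCoveringClaims)
    (C : D.CuspGalois) {c : D.PiC} (hc : c ∈ D.PiCbar) (hcX : c ∉ D.PiX) :
    {x : D.Cusp | ¬ D.inertia x ≤ D.piXarrow ∧ C.act c x ≠ x} = {D.ε1, D.ε2} := by
  ext x
  simp only [Set.mem_setOf_eq, Set.mem_insert_iff, Set.mem_singleton_iff]
  constructor
  · rintro ⟨hI, hmv⟩
    by_cases hx0 : x = D.ε0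
    · exact absurd (hx0 ▸ C.act_ε0 c hc) (hx0 ▸ hmv)
    · exact (h.not_inertia_le_piXarrow_iff hx0).mp hI
  · rintro (rfl | rfl)
    · exact ⟨h.not_inertia_ε1_le_piXarrow, by rw [C.act_ε1 c hc hcX]; exact D.ε1_ne_ε2.symm⟩
    · exact ⟨h.not_inertia_ε2_le_piXarrow, by rw [C.act_ε2 hc hcX]; exact D.ε1_ne_ε2⟩

/-! ### The splitting step: `Π_C̲` from the cusp action and the labels `ε⁰, ε′, ε″` -/

/-- Translation form of the `ZMod` heart: for `N` prime to `6` and `k ≠ 0`, a translation `m ↦ a + m`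
of `ℤ/N` stabilising `{0, k, -k}` is trivial. ([IUTchI] Cor 1.2 p.39) [claim: Mochizuki2012, status: disputed] -/
theorem Cor12Splitting.eq_zero_of_translation_stabilizes {N : ℕ} (hN : Nat.Coprime N 6) {k a : ZMod N}
    (hk : k ≠ 0) (h : ∀ m ∈ ({0, k, -k} : Set (ZMod N)), a + m ∈ ({0, k, -k} : Set (ZMod N))) : a = 0 := by
  refine Cor12Splitting.eq_zero_of_reflection_stabilizes hN hk fun m hm => ?_
  have hm' : -m ∈ ({0, k, -k} : Set (ZMod N)) := by
    simp only [Set.mem_insert_iff, Set.mem_singleton_iff] at hm ⊢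
    rcases hm with rfl | rfl | rfl
    · exact Or.inl neg_zero
    · exact Or.inr (Or.inr rfl)
    · exact Or.inr (Or.inl (neg_neg k))
  simpa [sub_eq_add_neg] using h (-m) hm'

/-- **Cor. 1.2, proof p. 39 — the splitting step, kernel form.**  Under the printed claims of p. 38,
the cusp action, and `#Cusp(X̲) = l` [[IUTchI] Def. 3.1 (d): `X̲_K` has `l` cusps; not carried by the
frozen record, hence the explicit hypothesis `hcard`]: an element `s ∈ Π_C` OUTSIDE `Π_X` [a
representative of a splitting of `Π_C/Π_X̲ ↠ Π_C/Π_X ≅ ℤ/2`] whose action on the cusps of `X̲`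
stabilises `{ε⁰, ε′, ε″}` lies in `Π_C̲`.  "[Since `l` is prime to `3`!]": `s` acts on the
`Gal(X̲/X) ≅ ℤ/l`-torsor of cusps by `n ↦ -n - b`, and `{0, ±k}` is stabilised only for `b = 0`
(`Cor12Splitting.eq_zero_of_reflection_stabilizes`). ([IUTchI] Cor 1.2 p.39) [claim: Mochizuki2012, status: disputed] -/
theorem ArrowCoveringClaims.mem_piCbar_of_act_stabilizes (h : D.ArrowCoveringClaims)
    (C : D.CuspGalois) (hcard : Nat.card D.Cusp = D.l) {s : D.PiC} (hs : s ∉ D.PiX)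
    (hstab : ∀ x ∈ ({D.ε0, D.ε1, D.ε2} : Set D.Cusp), C.act s x ∈ ({D.ε0, D.ε1, D.ε2} : Set D.Cusp)) :
    s ∈ D.PiCbar := by
  classical
  -- write `s = c * g` with `c ∈ Π_C̲ ∖ Π_X`, `g ∈ Π_X`
  obtain ⟨c, hc, hcX⟩ := h.exists_mem_piCbar_not_mem_piX
  set g : D.PiC := c⁻¹ * s with hg_def
  have hg : g ∈ D.PiX := by
    rw [hg_def, Subgroup.mul_mem_iff_of_index_two D.index_piX]
    exact ⟨fun hci => absurd (D.PiX.inv_mem_iff.mp hci) hcX, fun hsX => absurd hsX hs⟩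
  have hsg : s = c * g := by rw [hg_def, mul_inv_cancel_left]
  -- `g` (a "translation") stabilises `{ε⁰, ε′, ε″}` too, since `c⁻¹` permutes it
  have hc' : c⁻¹ ∈ D.PiCbar := D.PiCbar.inv_mem hc
  have hgstab : ∀ x ∈ ({D.ε0, D.ε1, D.ε2} : Set D.Cusp),
      C.act g x ∈ ({D.ε0, D.ε1, D.ε2} : Set D.Cusp) := by
    intro x hx
    have : C.act g x = C.act c⁻¹ (C.act s x) := by
      rw [hg_def, map_mul, Equiv.Perm.mul_apply]
    rw [this]
    exact C.act_mem_triple_of_mem_piCbar hc' (hstab x hx)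
  -- it suffices that `g` fixes `ε⁰`: then `g ∈ Π_X̲` (free action) and `s = c g ∈ Π_C̲`
  suffices hfix : C.act g D.ε0 = D.ε0 by
    have hgb : g ∈ D.PiXbar := C.free g hg D.ε0 hfix
    rw [hsg]
    exact D.PiCbar.mul_mem hc hgb.2
  -- coordinates: a generator `γ` of the action of `Π_X`, of order `N = #Cusp = l`
  obtain ⟨γ, hγ, hgen⟩ := C.exists_generator
  set τ : Equiv.Perm D.Cusp := C.act γ with hτ
  have hN : orderOf τ = D.l := (C.card_cusp_eq_orderOf hγ hgen).symm.trans hcard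
  have hcop : Nat.Coprime (orderOf τ) 6 := by rw [hN]; exact D.coprime_six
  -- powers fixing `ε⁰` are trivial
  have hfix0 : ∀ n : ℤ, (τ ^ n) D.ε0 = D.ε0 ↔ ((n : ZMod (orderOf τ)) = 0) := by
    intro n
    rw [ZMod.intCast_zmod_eq_zero_iff_dvd, orderOf_dvd_iff_zpow_eq_one]
    constructor
    · intro hn
      have hn' : C.act (γ ^ n) D.ε0 = D.ε0 := by rwa [map_zpow]
      have hmem : γ ^ n ∈ D.PiXbar := C.free _ (D.PiX.zpow_mem hγ n) D.ε0 hn'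
      have h1 := C.act_eq_one_of_mem_PiXbar₀ hmem
      rwa [map_zpow] at h1
    · intro hn; rw [hn]; rfl
  -- comparison of two powers at `ε⁰`
  have hcoord : ∀ n m : ℤ, (τ ^ n) D.ε0 = (τ ^ m) D.ε0 ↔ ((n : ZMod (orderOf τ)) = m) := by
    intro n m
    have key : (τ ^ n) D.ε0 = (τ ^ m) D.ε0 ↔ (τ ^ (n - m)) D.ε0 = D.ε0 := by
      rw [show n - m = -m + n by ring, zpow_add, zpow_neg, Equiv.Perm.mul_apply]
      constructor
      · intro hnm; rw [hnm]; simp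
      · intro hnm
        have := congrArg (τ ^ m) hnm
        simpa using this
    rw [key, hfix0 (n - m), Int.cast_sub, sub_eq_zero]
  -- the labels: `ε′ = τ^k ε⁰`, `ε″ = τ^(-k) ε⁰`, `act g = τ^b`
  obtain ⟨g₁, hg₁, hg₁ε⟩ := C.transitive D.ε0 D.ε1
  obtain ⟨k, hk⟩ := hgen g₁ hg₁
  obtain ⟨b, hb⟩ := hgen g hg
  have hε1 : D.ε1 = (τ ^ k) D.ε0 := by rw [← hg₁ε, hk]
  have hε2 : D.ε2 = (τ ^ (-k)) D.ε0 := by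
    have h2 : C.act c D.ε2 = D.ε1 := C.act_ε2 hc hcX
    -- `ε″ = ι̲ ε′ = ι̲ (g₁ ε⁰) = g₁⁻¹ (ι̲ ε⁰) = g₁⁻¹ ε⁰`
    have h3 : C.act c D.ε1 = C.act g₁⁻¹ D.ε0 := by
      rw [← hg₁ε, C.act_act_of_mem_PiCbar₀ hc hcX hg₁, C.act_ε0 c hc]
    rw [C.act_ε1 c hc hcX] at h3
    rw [h3, map_inv, hk, zpow_neg]
  have hk0 : (k : ZMod (orderOf τ)) ≠ 0 := by
    intro hk0
    have : (τ ^ k) D.ε0 = D.ε0 := (hfix0 k).mpr hk0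
    exact D.ε1_ne_ε0 (hε1.trans this)
  -- the stabilisation hypothesis in coordinates: `b + {0, k, -k} ⊆ {0, k, -k}`
  have key : ∀ m ∈ ({0, (k : ZMod (orderOf τ)), -(k : ZMod (orderOf τ))} : Set (ZMod (orderOf τ))),
      (b : ZMod (orderOf τ)) + m ∈
        ({0, (k : ZMod (orderOf τ)), -(k : ZMod (orderOf τ))} : Set (ZMod (orderOf τ))) := by
    -- each of the three labels `n ∈ {0, k, -k}` is carried to a label
    have step : ∀ n : ℤ, (τ ^ n) D.ε0 ∈ ({D.ε0, D.ε1, D.ε2} : Set D.Cusp) →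
        ((b + n : ℤ) : ZMod (orderOf τ)) ∈
          ({0, (k : ZMod (orderOf τ)), -(k : ZMod (orderOf τ))} : Set (ZMod (orderOf τ))) := by
      intro n hn
      have himg := hgstab _ hn
      rw [hb, ← Equiv.Perm.mul_apply, ← zpow_add] at himg
      simp only [Set.mem_insert_iff, Set.mem_singleton_iff] at himg ⊢
      rcases himg with h0 | h1 | h2
      · left
        have := (hcoord (b + n) 0).mp (by rw [zpow_zero]; exact h0)
        simpa using this
      · right; left
        exact (hcoord (b + n) k).mp (by rw [← hε1]; exact h1)
      · right; right
        have := (hcoord (b + n) (-k)).mp (by rw [← hε2]; exact h2)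
        simpa using this
    intro m hm
    simp only [Set.mem_insert_iff, Set.mem_singleton_iff] at hm
    rcases hm with rfl | rfl | rfl
    · simpa using step 0 (by rw [zpow_zero]; exact Or.inl rfl)
    · simpa using step k (by rw [← hε1]; exact Or.inr (Or.inl rfl))
    · simpa using step (-k) (by rw [← hε2]; exact Or.inr (Or.inr rfl))
  have hb0 : (b : ZMod (orderOf τ)) = 0 :=
    Cor12Splitting.eq_zero_of_translation_stabilizes hcop hk0 key
  -- hence `act g = τ^b` fixes `ε⁰`
  rw [hb]
  exact (hfix0 b).mpr hb0

/-- **Cor. 1.2, proof p. 39 — "the unique splitting that stabilizes …", both directions.**  For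
`s ∈ Π_C ∖ Π_X`: `s ∈ Π_C̲` iff the action of `s` on the cusps of `X̲` stabilises `{ε⁰, ε′, ε″}`.
([IUTchI] Cor 1.2 p.39) [claim: Mochizuki2012, status: disputed] -/
theorem ArrowCoveringClaims.mem_piCbar_iff_act_stabilizes (h : D.ArrowCoveringClaims)
    (C : D.CuspGalois) (hcard : Nat.card D.Cusp = D.l) {s : D.PiC} (hs : s ∉ D.PiX) :
    s ∈ D.PiCbar ↔
      ∀ x ∈ ({D.ε0, D.ε1, D.ε2} : Set D.Cusp), C.act s x ∈ ({D.ε0, D.ε1, D.ε2} : Set D.Cusp) :=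
  ⟨fun hsb _ hx => C.act_mem_triple_of_mem_piCbar hsb hx,
    h.mem_piCbar_of_act_stabilizes C hcard hs⟩

/-- **Cor. 1.2, proof p. 39 — `Π_C̲ ⊆ Π_C` reconstructed** from `Π_X ⊇ Π_X̲`, the cusp action and
the labels `ε⁰, ε′, ε″`: `Π_C̲ = Π_X̲ ∪ {s ∈ Π_C ∖ Π_X : s` stabilises `{ε⁰, ε′, ε″}}` (membership form).
([IUTchI] Cor 1.2 p.39) [claim: Mochizuki2012, status: disputed] -/
theorem ArrowCoveringClaims.mem_piCbar_iff (h : D.ArrowCoveringClaims) (C : D.CuspGalois)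
    (hcard : Nat.card D.Cusp = D.l) (s : D.PiC) :
    s ∈ D.PiCbar ↔ (s ∈ D.PiX ∧ s ∈ D.PiXbar) ∨
      (s ∉ D.PiX ∧ ∀ x ∈ ({D.ε0, D.ε1, D.ε2} : Set D.Cusp),
        C.act s x ∈ ({D.ε0, D.ε1, D.ε2} : Set D.Cusp)) := by
  by_cases hsX : s ∈ D.PiX
  · constructor
    · intro hsb; exact Or.inl ⟨hsX, hsX, hsb⟩
    · rintro (⟨-, hsb⟩ | ⟨hn, -⟩)
      · exact hsb.2
      · exact absurd hsX hn
  · rw [h.mem_piCbar_iff_act_stabilizes C hcard hsX]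
    constructor
    · intro hst; exact Or.inr ⟨hsX, hst⟩
    · rintro (⟨hX, -⟩ | ⟨-, hst⟩)
      · exact absurd hX hsX
      · exact hst

end PuncturedEllipticData

end Literature.IUT.HodgeTheaters
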